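/-
Copyright: statement-level skeleton of a published paper (lit-balaban cell, Phase-2 proof seat p32 gen 47). No claims beyond
what the kernel checks below.
-/
import Literature.MathematicalPhysics.QuantumFieldTheory.Balaban1983to89.B3Eq121SymmetryWeights
import Literature.MathematicalPhysics.QuantumFieldTheory.Balaban1983to89.B3OnePIChainClassValues

/-!
# B3 — T. Bałaban, *(Higgs)₂,₃ quantum fields in a finite volume. III. Renormalization*, CMP **88** (1983) 411–445
[Balaban1983Higgs3] — p. 416 [PDF 6] (1.21)–(1.22): **THE SYMMETRY-WEIGHTED CLASS VALUES SATISFY (1.21)** — gen 46's FILE E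
`B3Eq121SymmetryWeights` ((1.21) with the factors `1/|Aut|` written, under the two transport HYPOTHESES `hA` / `hdeg`)
INSTANTIATED at p37's class regrouping `B3OnePIChainClassValues.classRegrouping` (the terms of (1.21) indexed by the
isomorphism classes of graphs, valued `C₀·K(representative)·C₀`), which DISCHARGES `hA` and `hdeg`: the series
`G = Σ_g (1/|Aut g|)·value g·e^{order g}` over the bare line and the classes of unglueable insertions obeys r15's resummed
(1.21) `G = C₀ + G·X·C₀` with `X = Σ_c (1/|Aut c|)·K(rep c)·e^{deg c}` over the letter classes, equals the chain series of
the weighted letters, equals the printed `Σ_n C₀[XC₀]ⁿ`, order by order as finite sums, and is the ONLY solution of the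
resummed equation — the hypotheses left are `hne` / `hfin` on the letter orders, exactly as in p37's `eq121_classValue`

statement-level skeleton of published theorems with citation tags; proofs where landed; nothing here is a claim about
the Yang–Mills mass gap

PDF held: `paper:balaban1983-higgs-2-3-quantum-fields-finite-volume` (journal page = PDF page + 410); p. 416 read on the ×2
render `run/shared/lean/pub/pub-balaban/b2b-balaban-ref1/pages/1983-cmp88-higgs23-III/1983-cmp88-higgs23-III-p006-x2.png`
(as for FILE E).

CITATION HEADER (lean-in-tree rule).  lit-balaban TYPED SKELETON (HOME `run/shared/lean/pub/lit-balaban/`), PHASE 2, seat p32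
gen 47 (unit `lit-balaban-p32`; TAKING #1 line HOME/STATUS.md 2026-08-25T03:22Z, free-target protocol G.5-34(d) = gen 46's
HANDOFF (c)(α)), row **B3.Eq1.19-1.22** ((1.21)–(1.22), p. 416) of `HOME/lit-balaban-r15/ROWS-B3.md` (fold owner r15; head
`proved` under the lead g12 HEAD WORD Q25; this file is an OPTIONAL located member of its (1.21) cell, zero head weight).
CONSUMES BY NAME: gen 46's FILE E `B3Eq121SymmetryWeights` (`letterWeight`, `termWeight`, `weighted_hamp`,
`sigmaSeries_weighted_eq_greenSeries`, `eq121_weighted`, `sigmaSeries_weighted_eq_tsum_dysonTerm`); p37's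
`B3ChainRegroupingValues` (`LetterDressing`, `objValue`, `objOrder`, `objDressing`, `objValue_eq_chainAmp`,
`objOrder_eq_chainDeg`, `kernel_rep_eq_of_iso`) and `B3OnePIChainClassValues` (`classRegrouping`,
`objIndexEquiv_classRegrouping`, `sigmaSeries_classValue_eq_greenSeries`); BRICK 2 = gen 41's `B3Eq121OnePIChains`
(`chainAmp`, `chainDeg`, `sigmaSeries`, `greenSeries`, `coeff_greenSeries_eq_sum_dysonTerm`,
`coeff_greenSeries_of_degree_eq_one`, `eq121_iff_eq_greenSeries`); gen 44's `B3OnePIChainClasses` (`LetterClass`,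
`UnglueableClass`, `rep`, `classEquivList`); p37's `B3OnePIChainAmplitude.Dressing.kernel`, `B3GraphIsoAmplitude.pullDressing`;
the typer's `B3Sect1TwoPoint.Eq121` / `dysonTerm`.  Nothing re-declared; no declaration is added to another file's namespace.

THE PRINTED TEXT (verbatim).  p. 416: *"The function G^ε has a perturbative expansion of the following structure
G^ε = Σ_{n=0}^∞ C₀^ε[(−δm² + Σ^ε + ∂^{ε*}Σ₁^ε + Σ₁^{ε*}∂^ε + ∂^{ε*}Σ₂^ε∂^ε)C₀^ε]ⁿ, (1.21) where C₀^ε = (−Δ₀^ε + m²)^{−1}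
and Σ^ε, Σ₁^ε, Σ₂^ε are given by amputated, one-particle-irreducible graphs of the expansion of G^ε."*  p. 416, after
(1.22): *"Here we did not write, and we will not write in the future, combinatoric factors before the graphs, understanding that
they are a part of the graphical description."*

KIND «(ours)» (G.5-54).  Plumbing: FILE E proved the weighted identities for ANY kernels `A`, `a` consistent along gen 44's
index bijection `classEquivList` (`hA`) with additive orders (`hdeg`); p37 proved that the class values through
representatives ARE consistent (`objValue_eq_chainAmp`, the `kernel_pull` step) with additive orders (`objOrder_eq_chainDeg`)
and that the class regrouping's index bijection IS `classEquivList` (`objIndexEquiv_classRegrouping`, `rfl`).  This file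
composes the two; print provenance is claimed only for the two sentences quoted.

WHAT IS PROVED (theorems only; no `def`, no `Prop` fact, no `sorry`; standard axioms).  Throughout: `C : IS → IS → ℝ` the
free propagator as a kernel (`C₀ = Matrix.of C`), `Dc` a dressing of every letter class's representative (p37's
`LetterDressing (classRegrouping n̄)`), `deg : LetterClass n̄ → σ →₀ ℕ` the orders of the letter classes; `value g :=
objValue (classRegrouping n̄) bS bV bO C Dc g` (`C₀` on the bare line `none`, `C₀·K(rep y)·C₀` on a class `y`), `order g :=
objOrder (classRegrouping n̄) deg g`; weights `termWeight g` (`1` / `1/|Aut ⟦T⟧|`) and `letterWeight c = 1/|Aut c|` of FILE E.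
* `§1` FILE E's HYPOTHESES ON THE CLASS REGROUPING: **`classValue_eq_chainAmp`** (`hA`: `value g = C₀K₁C₀⋯K_mC₀` of the
  letter classes of `g` along `classEquivList`), **`classOrder_eq_chainDeg`** (`hdeg`).
* `§2` THE WEIGHTED CLASS SERIES: **`weightedClassValue_hamp`** (`(1/|Aut g|)·value g` is the chain kernel of the weighted
  letters `(1/|Aut c|)·K(rep c)`), **`sigmaSeries_weightedClassValue_eq_greenSeries`**, **`eq121_weightedClassValue`**
  (r15's `Eq121 G (C C₀) X` in `(Matrix IS IS ℝ)[[σ]]`, given `hne` / `hfin`),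
  **`sigmaSeries_weightedClassValue_eq_tsum_dysonTerm`** (`G = Σ'_n C₀[XC₀]ⁿ`).
* `§3` ORDER BY ORDER AND UNIQUENESS (BRICK 2's `§6` / `§8` read for the class series, weighted and unweighted):
  **`coeff_weightedClassValue_eq_sum_dysonTerm`** (`coeff_d G = Σ_{n ≤ |d|} coeff_d C₀[XC₀]ⁿ`, a finite sum at each order),
  **`coeff_weightedClassValue_of_degree_eq_one`** (at total order one `coeff_d G = C₀·coeff_d X·C₀`),
  **`eq121_iff_eq_weightedClassValue`** (a formal series solves the weighted resummed (1.21) iff it is the weighted class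
  series); `coeff_classValue_eq_sum_dysonTerm`, `eq121_iff_eq_classValue`, `sigmaSeries_classValue_eq_tsum_dysonTerm` (the same,
  and `= Σ'_n C₀[XC₀]ⁿ`, for p37's unweighted class series).
* `§4` **`weightedValue_rep_eq_of_iso`**: the weighted value of a class computed on ANY representative (dressed through an
  isomorphism onto the chosen one) is the same (p37's `kernel_rep_eq_of_iso`).

HONEST SCOPE.  IN ONE SENTENCE (owner r15's header ask, 2026-08-25T03:22:44Z): after the discharge of `hA` / `hdeg` the ONLY
hypotheses left are `hne` / `hfin` on the letter orders `deg` (exactly as in p37's `eq121_classValue`), and the weights are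
FILE E's vertex-relabelling frequencies `1/|Aut|` — a READING of p. 416's unwritten combinatoric factors restricted to vertex
labels, not print's full Feynman factors.  In detail: (i) = FILE E's: the weights are the RIGID VERTEX-RELABELLING symmetry
numbers `1/|Aut|` of gen 44's classes (FILE 2 / FILE D; legs rigid, the two marked legs fixed) — a READING of p. 416's unwritten
*"combinatoric factors"* restricted to vertex labels, not print's full Feynman factors.  (ii) = p37's: the dressing of the
letter representatives is a PARAMETER `Dc`; index = gen 44's `Option (UnglueableClass n̄)` / `LetterClass n̄` (no bare `−δm²`
letter, no sorting of the letters into `Σ^ε, ∂^{ε*}Σ₁^ε, Σ₁^{ε*}∂^ε, ∂^{ε*}Σ₂^ε∂^ε`, insertions with vector separating lines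
outside).  (iii) `hne` (every letter class has positive order) and `hfin` (finitely many letter classes of each order) remain
HYPOTHESES on the order function `deg`: a concrete class-order function discharging them is NOT claimed here — at fixed
`(d_s, d_v)` with the counterterm orders of the (1.7) vertices NOT counted there are infinitely many classes (FILE 1's
`B3GraphFiniteOrder.not_finite_connected_orders_zero`), so such an index must carry the counterterm orders (FILE 1 / FILE C's
`ordersCt` provisos); left to the owner's grading.
(iv) Nothing analytic; no Wick/Gaussian identification of `G` with the concrete (1.19) (p33's / p39's lanes).
-/

namespace Literature.MathematicalPhysics.QuantumFieldTheory.Balaban1983to89.B3Eq121WeightedClassValues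

open B3Sect1TwoPoint (dysonTerm Eq121)
open B3Eq121OnePIChains B3OnePIChainAmplitude B3GraphIsoAmplitude B3OnePIChainGlue B3GraphIso B3OnePIChainClasses
  B3ChainRegroupingValues B3OnePIChainClassValues B3Eq121SymmetryWeights

noncomputable section

variable {nbar : ℕ} {SF VF OF IS IV IO : Type*} [Fintype IS] [Fintype IV] [Fintype IO] [DecidableEq IS]
  (bS : IS → SF) (bV : IV → VF) (bO : IO → OF) (C : IS → IS → ℝ)
  (Dc : LetterDressing (classRegrouping nbar) SF VF OF IS IV IO) {σ : Type*} (deg : LetterClass nbar → σ →₀ ℕ)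

/-! ## §1 FILE E's transport hypotheses hold on the class regrouping -/

/-- **`hA` ON THE CLASS REGROUPING**: the value of a term of (1.21) indexed by gen 44's classes — `C₀` for the bare line,
`C₀·K(rep y)·C₀` for the class `y` of an unglueable insertion (p37's `objValue` on `classRegrouping`) — IS BRICK 2's chain
kernel `C₀K₁C₀⋯K_mC₀` of the amputated kernels of the representatives of its letter classes, read along `classEquivList`
(p37's `objValue_eq_chainAmp` — the `kernel_pull` step — through `objIndexEquiv_classRegrouping`).
[cite: Balaban1983Higgs3, (1.21) p.416] [cite: Balaban1983Higgs3, p.415] -/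
theorem classValue_eq_chainAmp (g : Option (UnglueableClass nbar)) :
    objValue (classRegrouping nbar) bS bV bO C Dc g =
      chainAmp (Matrix.of C) (fun c => (Dc c).kernel bS bV bO) (classEquivList g) := by
  rw [← objIndexEquiv_classRegrouping]
  exact objValue_eq_chainAmp (classRegrouping nbar) bS bV bO C Dc g

/-- **`hdeg` ON THE CLASS REGROUPING**: the order of a term is BRICK 2's chain order (the sum of the orders of its letter
classes) along `classEquivList` (p37's `objOrder_eq_chainDeg`). [cite: Balaban1983Higgs3, (1.21) p.416] -/
theorem classOrder_eq_chainDeg (g : Option (UnglueableClass nbar)) :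
    objOrder (classRegrouping nbar) deg g = chainDeg deg (classEquivList g) := by
  rw [← objIndexEquiv_classRegrouping]
  exact objOrder_eq_chainDeg (classRegrouping nbar) deg g

/-! ## §2 (1.21) for the symmetry-weighted class values -/

/-- **THE WEIGHTED CLASS VALUES ARE CONSISTENT ALONG (1.21)**: `(1/|Aut g|)·value g` is the chain kernel of the weighted
letter kernels `(1/|Aut c|)·K(rep c)` (FILE E's `weighted_hamp`, its hypothesis `hA` discharged by `§1`).
[cite: Balaban1983Higgs3, (1.21)–(1.22) p.416] -/
theorem weightedClassValue_hamp (g : Option (UnglueableClass nbar)) :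
    termWeight g • objValue (classRegrouping nbar) bS bV bO C Dc g =
      chainAmp (Matrix.of C) (fun c => letterWeight c • (Dc c).kernel bS bV bO) (classEquivList g) :=
  weighted_hamp (Matrix.of C) (fun c => (Dc c).kernel bS bV bO) (objValue (classRegrouping nbar) bS bV bO C Dc)
    (classValue_eq_chainAmp bS bV bO C Dc) g

/-- **(1.21) WITH THE COMBINATORIC FACTORS WRITTEN, for the class values, I**: the generating series
`G = Σ_g (1/|Aut g|)·value g·e^{order g}` over the bare line and the classes of unglueable insertions IS BRICK 2's chain series
of the weighted letter classes `(1/|Aut c|)·K(rep c)` (FILE E's `sigmaSeries_weighted_eq_greenSeries`, `hA` / `hdeg`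
discharged). [cite: Balaban1983Higgs3, (1.21)–(1.22) p.416] -/
theorem sigmaSeries_weightedClassValue_eq_greenSeries :
    sigmaSeries (fun g => termWeight g • objValue (classRegrouping nbar) bS bV bO C Dc g) (objOrder (classRegrouping nbar) deg) =
      greenSeries (Matrix.of C) (fun c => letterWeight c • (Dc c).kernel bS bV bO) deg :=
  sigmaSeries_weighted_eq_greenSeries (Matrix.of C) (fun c => (Dc c).kernel bS bV bO)
    (objValue (classRegrouping nbar) bS bV bO C Dc) deg (objOrder (classRegrouping nbar) deg)
    (classValue_eq_chainAmp bS bV bO C Dc) (classOrder_eq_chainDeg deg)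

/-- **(1.21) WITH THE COMBINATORIC FACTORS WRITTEN, for the class values, II — THE DYSON EQUATION**: if every letter class
has positive order and each order carries finitely many letter classes, r15's resummed (1.21) `Eq121 G (C C₀) X`
(`G = C₀ + G·X·C₀`) HOLDS in `(Matrix IS IS ℝ)[[σ]]` for `G = Σ_g (1/|Aut g|)·value g·e^{order g}` and the weighted
self-energy `X = Σ_c (1/|Aut c|)·K(rep c)·e^{deg c}` (FILE E's `eq121_weighted`, `hA` / `hdeg` discharged).
[cite: Balaban1983Higgs3, (1.21)–(1.22) p.416] -/
theorem eq121_weightedClassValue (hne : ∀ c, deg c ≠ 0) (hfin : ∀ d, {c | deg c = d}.Finite) :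
    Eq121 (sigmaSeries (fun g => termWeight g • objValue (classRegrouping nbar) bS bV bO C Dc g)
        (objOrder (classRegrouping nbar) deg))
      (MvPowerSeries.C (Matrix.of C)) (sigmaSeries (fun c => letterWeight c • (Dc c).kernel bS bV bO) deg) :=
  eq121_weighted (Matrix.of C) (fun c => (Dc c).kernel bS bV bO) (objValue (classRegrouping nbar) bS bV bO C Dc) deg
    (objOrder (classRegrouping nbar) deg) (classValue_eq_chainAmp bS bV bO C Dc) (classOrder_eq_chainDeg deg) hne hfin

open MvPowerSeries.WithPiTopology in
/-- **(1.21) WITH THE COMBINATORIC FACTORS WRITTEN, for the class values, III — AS THE PRINTED SERIES**: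
`G = Σ'_{n} C₀[XC₀]ⁿ` in `(Matrix IS IS ℝ)[[σ]]` (product topology on coefficients), `G` and `X` as in `eq121_weightedClassValue`
(FILE E's `sigmaSeries_weighted_eq_tsum_dysonTerm`). [cite: Balaban1983Higgs3, (1.21) p.416] -/
theorem sigmaSeries_weightedClassValue_eq_tsum_dysonTerm (hne : ∀ c, deg c ≠ 0) (hfin : ∀ d, {c | deg c = d}.Finite) :
    sigmaSeries (fun g => termWeight g • objValue (classRegrouping nbar) bS bV bO C Dc g) (objOrder (classRegrouping nbar) deg) =
      ∑' n, dysonTerm (MvPowerSeries.C (Matrix.of C))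
        (sigmaSeries (fun c => letterWeight c • (Dc c).kernel bS bV bO) deg) n :=
  sigmaSeries_weighted_eq_tsum_dysonTerm (Matrix.of C) (fun c => (Dc c).kernel bS bV bO)
    (objValue (classRegrouping nbar) bS bV bO C Dc) deg (objOrder (classRegrouping nbar) deg)
    (classValue_eq_chainAmp bS bV bO C Dc) (classOrder_eq_chainDeg deg) hne hfin

/-! ## §3 Order by order; uniqueness -/

/-- **(1.21) ORDER BY ORDER for the weighted class series**: at every order `d` the coefficient of
`G = Σ_g (1/|Aut g|)·value g·e^{order g}` is the FINITE sum `Σ_{n ≤ |d|} coeff_d (C₀[XC₀]ⁿ)` of the first `|d| + 1` terms of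
the printed series with the weighted self-energy `X` (BRICK 2's `coeff_greenSeries_eq_sum_dysonTerm` through `§2`).
[cite: Balaban1983Higgs3, (1.21) p.416] -/
theorem coeff_weightedClassValue_eq_sum_dysonTerm (hne : ∀ c, deg c ≠ 0) (hfin : ∀ d, {c | deg c = d}.Finite)
    (d : σ →₀ ℕ) :
    MvPowerSeries.coeff d (sigmaSeries (fun g => termWeight g • objValue (classRegrouping nbar) bS bV bO C Dc g)
        (objOrder (classRegrouping nbar) deg)) =
      ∑ n ∈ Finset.range (d.degree + 1), MvPowerSeries.coeff d
        (dysonTerm (MvPowerSeries.C (Matrix.of C)) (sigmaSeries (fun c => letterWeight c • (Dc c).kernel bS bV bO) deg) n) := by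
  rw [sigmaSeries_weightedClassValue_eq_greenSeries bS bV bO C Dc deg]
  exact coeff_greenSeries_eq_sum_dysonTerm hne hfin d

/-- **FIRST ORDER of the weighted class series**: at an order `d` of total degree one, `coeff_d G = C₀·(coeff_d X)·C₀` — the only
terms are single weighted letters between two free propagators (BRICK 2's `coeff_greenSeries_of_degree_eq_one` through `§2`).
[cite: Balaban1983Higgs3, (1.21) p.416] -/
theorem coeff_weightedClassValue_of_degree_eq_one (hne : ∀ c, deg c ≠ 0) (hfin : ∀ d, {c | deg c = d}.Finite)
    {d : σ →₀ ℕ} (hd : d.degree = 1) :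
    MvPowerSeries.coeff d (sigmaSeries (fun g => termWeight g • objValue (classRegrouping nbar) bS bV bO C Dc g)
        (objOrder (classRegrouping nbar) deg)) =
      Matrix.of C * MvPowerSeries.coeff d (sigmaSeries (fun c => letterWeight c • (Dc c).kernel bS bV bO) deg) *
        Matrix.of C := by
  rw [sigmaSeries_weightedClassValue_eq_greenSeries bS bV bO C Dc deg]
  exact coeff_greenSeries_of_degree_eq_one hne hfin hd

/-- **UNIQUENESS for the weighted resummed (1.21)**: a formal series `G` satisfies r15's `Eq121 G (C C₀) X` with the weighted
self-energy `X = Σ_c (1/|Aut c|)·K(rep c)·e^{deg c}` IFF `G` is the weighted class series `Σ_g (1/|Aut g|)·value g·e^{order g}`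
(BRICK 2's `eq121_iff_eq_greenSeries` through `§2`). [cite: Balaban1983Higgs3, (1.21)–(1.22) p.416] -/
theorem eq121_iff_eq_weightedClassValue (hne : ∀ c, deg c ≠ 0) (hfin : ∀ d, {c | deg c = d}.Finite)
    {G : MvPowerSeries σ (Matrix IS IS ℝ)} :
    Eq121 G (MvPowerSeries.C (Matrix.of C)) (sigmaSeries (fun c => letterWeight c • (Dc c).kernel bS bV bO) deg) ↔
      G = sigmaSeries (fun g => termWeight g • objValue (classRegrouping nbar) bS bV bO C Dc g)
        (objOrder (classRegrouping nbar) deg) := by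
  rw [sigmaSeries_weightedClassValue_eq_greenSeries bS bV bO C Dc deg]
  exact eq121_iff_eq_greenSeries hne hfin

/-- (1.21) ORDER BY ORDER for p37's UNWEIGHTED class series `Σ_g value g·e^{order g}` (BRICK 2's
`coeff_greenSeries_eq_sum_dysonTerm` through p37's `sigmaSeries_classValue_eq_greenSeries`):
`coeff_d = Σ_{n ≤ |d|} coeff_d (C₀[XC₀]ⁿ)` with `X = Σ_c K(rep c)·e^{deg c}`. [cite: Balaban1983Higgs3, (1.21) p.416] -/
theorem coeff_classValue_eq_sum_dysonTerm (hne : ∀ c, deg c ≠ 0) (hfin : ∀ d, {c | deg c = d}.Finite) (d : σ →₀ ℕ) :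
    MvPowerSeries.coeff d (sigmaSeries (objValue (classRegrouping nbar) bS bV bO C Dc) (objOrder (classRegrouping nbar) deg)) =
      ∑ n ∈ Finset.range (d.degree + 1), MvPowerSeries.coeff d
        (dysonTerm (MvPowerSeries.C (Matrix.of C)) (sigmaSeries (fun c => (Dc c).kernel bS bV bO) deg) n) := by
  rw [sigmaSeries_classValue_eq_greenSeries bS bV bO C Dc deg]
  exact coeff_greenSeries_eq_sum_dysonTerm hne hfin d

/-- UNIQUENESS for p37's UNWEIGHTED resummed (1.21): `Eq121 G (C C₀) X` with `X = Σ_c K(rep c)·e^{deg c}` IFF `G` is the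
unweighted class series (BRICK 2's `eq121_iff_eq_greenSeries` through p37's `sigmaSeries_classValue_eq_greenSeries`).
[cite: Balaban1983Higgs3, (1.21) p.416] -/
theorem eq121_iff_eq_classValue (hne : ∀ c, deg c ≠ 0) (hfin : ∀ d, {c | deg c = d}.Finite)
    {G : MvPowerSeries σ (Matrix IS IS ℝ)} :
    Eq121 G (MvPowerSeries.C (Matrix.of C)) (sigmaSeries (fun c => (Dc c).kernel bS bV bO) deg) ↔
      G = sigmaSeries (objValue (classRegrouping nbar) bS bV bO C Dc) (objOrder (classRegrouping nbar) deg) := by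
  rw [sigmaSeries_classValue_eq_greenSeries bS bV bO C Dc deg]
  exact eq121_iff_eq_greenSeries hne hfin

open MvPowerSeries.WithPiTopology in
/-- p37's UNWEIGHTED class series AS THE PRINTED SERIES: `Σ_g value g·e^{order g} = Σ'_{n} C₀[XC₀]ⁿ` in `(Matrix IS IS ℝ)[[σ]]`
with `X = Σ_c K(rep c)·e^{deg c}` (BRICK 2's `greenSeries_eq_tsum_dysonTerm` through p37's
`sigmaSeries_classValue_eq_greenSeries`). [cite: Balaban1983Higgs3, (1.21) p.416] -/
theorem sigmaSeries_classValue_eq_tsum_dysonTerm (hne : ∀ c, deg c ≠ 0) (hfin : ∀ d, {c | deg c = d}.Finite) :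
    sigmaSeries (objValue (classRegrouping nbar) bS bV bO C Dc) (objOrder (classRegrouping nbar) deg) =
      ∑' n, dysonTerm (MvPowerSeries.C (Matrix.of C)) (sigmaSeries (fun c => (Dc c).kernel bS bV bO) deg) n := by
  rw [sigmaSeries_classValue_eq_greenSeries bS bV bO C Dc deg]
  exact greenSeries_eq_tsum_dysonTerm hne hfin

/-! ## §4 The weighted value does not depend on the representative -/

/-- **ANY REPRESENTATIVE GIVES THE SAME WEIGHTED VALUE**: for an insertion `T` in the class `y`, isomorphic to the chosen
representative by `e : T ≅ rep y` and dressed through `e`, the weighted value `(1/|Aut ⟦T⟧|)·C₀·K(T)·C₀` equals the weighted class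
value `(1/|Aut y|)·value y` (p37's `kernel_rep_eq_of_iso`: the amputated kernel is an isomorphism invariant; the weight is a
class function by construction). [cite: Balaban1983Higgs3, p.415] [cite: Balaban1983Higgs3, (1.21)–(1.22) p.416] -/
theorem weightedValue_rep_eq_of_iso {T : TwoLegGraph nbar} (y : UnglueableClass nbar)
    (e : TwoLegGraphIso T (rep y.1)) :
    termWeight (some y) • (Matrix.of C *
        (pullDressing e (objDressing (classRegrouping nbar) C Dc y)).kernel bS bV bO * Matrix.of C) =
      termWeight (some y) • objValue (classRegrouping nbar) bS bV bO C Dc (some y) :=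
  congrArg (fun K : Matrix IS IS ℝ => termWeight (some y) • (Matrix.of C * K * Matrix.of C))
    (kernel_rep_eq_of_iso (classRegrouping nbar) bS bV bO C Dc y e)

end

end Literature.MathematicalPhysics.QuantumFieldTheory.Balaban1983to89.B3Eq121WeightedClassValues
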